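import Literature.Computability.QuantumComplexity.HadamardGadgetLoop
import Literature.Computability.QuantumComplexity.HadamardGadgetLexer
import HarnessLib

/-!
# Uniformity of the Hadamard-gadget family, V: prefix, set-up, boundary layers and output

Topic `Literature/Computability/QuantumComplexity`; fifth of the files proving that the compiled
post-selected IQP family `HGadget.Hop.gadgetFamily F` is uniform (Bremner–Jozsa–Shepherd 2011,
proof of Thm. 1 with Def. 1). Around the gate loop of `HadamardGadgetLoop.lean`, the machine

* reads the prefix `1ⁿ 0 (1 b₀)(1 b₁)… 0 1ᵐ 0` of the lexer's stream into `nU = 1ⁿ`, `nB = bin n`,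
  `mU = 1ᵐ`, leaving the gate tokens in `g` (`pre1`, `pre2`, `pre3`, total on every input);
* sets up `NU = 1ᴺ`, `x = bin (N + 1)`, `LU = 1ᴸ`, `SU = 1^{2^L}`, the stage numerals `2, 3, 4`,
  `sfU = 1³`, the countdown `lc = 1ᴸ`, `k1 = bin 1` (`setup`);
* prints the initial hop layer (`initLayer`: inputs `i ↦ pos 2 i`, ancillas `pos 1 (n+j) ↦ pos 2 (n+j)`),
  runs the gate loop, prints the final layer (`finalLayer`) and assembles the description with its
  header (`output`), and the post-selection length in unary (`outputPl`).

All routines come with exact functional models and step counts; the program `prog` and its `FP`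
statement are in the sequel.

## References

* M. J. Bremner, R. Jozsa, D. J. Shepherd, Proc. R. Soc. A 467 (2011) 459–472, Def. 1, Thm. 1.
* S. Arora, B. Barak, *Computational Complexity: A Modern Approach*, CUP 2009, §1.3, §6.1.
-/

namespace Literature.Computability.QuantumComplexity

open _root_.Computability Complexity Complexity.Com Cryptography Thm25Lex
open Thm25Asm (pushList runs_pushList emitRep runs_emitRep incR runs_incR IsFlag isFlag_nil isFlag_true isFlag_flag)

namespace HGadget.Hop

namespace Asm

variable {L N K : ℕ}

/-! ### The prefix loops -/

/-- Read `1ⁿ 0`: count the ones into `nU`, move the rest of the input to `g1`. [folklore] -/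
def pre1 : Com R := Com.loop .inp (Com.push .nU true) (Com.move .inp .g1 .t)

/-- Model of `pre1`: (ones counted, rest). [folklore] -/
def pre1M : List Bool → ℕ × List Bool
  | true :: w => ((pre1M w).1 + 1, (pre1M w).2)
  | false :: w => (0, w)
  | [] => (0, [])

/-- `pre1M` on `1ⁿ 0 w`. [folklore] -/
theorem pre1M_spec (n : ℕ) (w : List Bool) : pre1M (List.replicate n true ++ false :: w) = (n, w) := by
  induction n with
  | zero => rfl
  | succ n ih => simp [List.replicate_succ, pre1M, ih]

/-- The rest is shorter. [folklore] -/
theorem pre1M_len : ∀ w : List Bool, (pre1M w).1 + (pre1M w).2.length ≤ w.length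
  | true :: w => by have := pre1M_len w; simp only [pre1M, List.length_cons]; omega
  | false :: w => by simp [pre1M]
  | [] => by simp [pre1M]

/-- `pre1` runs to its model (on any input; `g1`, `t` empty). [folklore] -/
theorem runs_pre1 : ∀ (w : List Bool) (s : St), s.inp = w → s.g1 = [] → s.t = [] →
    Runs pre1 s.regs { s with inp := [], nU := List.replicate (pre1M w).1 true ++ s.nU, g1 := (pre1M w).2 }.regs (6 * w.length + 3)
  | [], s, hw, hg, _ => by
    refine (Runs.loop_nil _ _ (show s.regs R.inp = [] from hw)).of_eq ?_ (by omega)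
    cases s; simp only at hw hg; subst hw; subst hg; rfl
  | true :: w, s, hw, hg, ht => by
    have hk : s.regs R.inp = true :: w := hw
    have hb : Runs (Com.push R.nU true) (Function.update s.regs R.inp w) ({ s with inp := w, nU := true :: s.nU } : St).regs 1 :=
      (Runs.push _ _ _).of_eq (by rw [St.upd_inp, St.upd_nU]; rfl) le_rfl
    have ih := runs_pre1 w ({ s with inp := w, nU := true :: s.nU } : St) rfl hg ht
    refine (Runs.loop_true hk hb ih).of_eq ?_ ?_
    · simp only [pre1M, List.replicate_succ', List.append_assoc, List.singleton_append]
    · simp only [List.length_cons]; omega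
  | false :: w, s, hw, hg, ht => by
    have hk : s.regs R.inp = false :: w := hw
    have hb : Runs (Com.move R.inp R.g1 R.t) (Function.update s.regs R.inp w) ({ s with inp := ([] : List Bool), g1 := w } : St).regs
        (6 * w.length + 2) := by
      have hm := runs_move (a := R.inp) (b := R.g1) (t := R.t) (by decide) (by decide) (by decide) ({ s with inp := w } : St).regs
        (by simpa using ht)
      rw [St.upd_inp]
      refine hm.of_eq ?_ (by simp)
      rw [St.upd_inp, St.upd_g1]; simp [hg]
    have h2 : Runs pre1 ({ s with inp := ([] : List Bool), g1 := w } : St).regs ({ s with inp := ([] : List Bool), g1 := w } : St).regs 1 :=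
      Runs.loop_nil _ _ rfl
    refine (Runs.loop_false hk hb h2).of_eq ?_ ?_
    · simp [pre1M]
    · simp only [List.length_cons]; omega

/-- Read `(1 b)… 0`: the announced bits go to `t` (reversed), the rest to `g2`. [folklore] -/
def pre2 : Com R := Com.loop .g1 (Com.pop .g1 (Com.push .t true) (Com.push .t false) Com.skip) (Com.move .g1 .g2 .t2)

/-- Model of `pre2`: (announced bits in order, rest). [folklore] -/
def pre2M : List Bool → List Bool × List Bool
  | true :: b :: w => (b :: (pre2M w).1, (pre2M w).2)
  | [true] => ([], [])
  | false :: w => ([], w)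
  | [] => ([], [])

/-- `pre2M` on `annBits u ++ 0 :: w`. [folklore] -/
theorem pre2M_spec (u w : List Bool) : pre2M (HGadget.Lex.annBits u ++ false :: w) = (u, w) := by
  induction u with
  | nil => rfl
  | cons b u ih => simp [HGadget.Lex.annBits_cons, pre2M, ih]

/-- The rest is shorter. [folklore] -/
theorem pre2M_len : ∀ w : List Bool, (pre2M w).1.length + (pre2M w).2.length ≤ w.length
  | true :: b :: w => by have := pre2M_len w; simp only [pre2M, List.length_cons]; omega
  | [true] => by simp [pre2M]
  | false :: w => by simp [pre2M]
  | [] => by simp [pre2M]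

/-- `pre2` runs to its model (on any content of `g1`; `g2`, `t2` empty). [folklore] -/
theorem runs_pre2 : ∀ (w : List Bool) (s : St), s.g1 = w → s.g2 = [] → s.t2 = [] →
    Runs pre2 s.regs { s with g1 := [], t := (pre2M w).1.reverse ++ s.t, g2 := (pre2M w).2 }.regs (6 * w.length + 3)
  | [], s, hw, hg, _ => by
    refine (Runs.loop_nil _ _ (show s.regs R.g1 = [] from hw)).of_eq ?_ (by omega)
    cases s; simp only at hw hg; subst hw; subst hg; rfl
  | [true], s, hw, hg, _ => by
    have hk : s.regs R.g1 = true :: [] := hw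
    have hb : Runs (Com.pop R.g1 (Com.push R.t true) (Com.push R.t false) Com.skip) (Function.update s.regs R.g1 [])
        ({ s with g1 := ([] : List Bool) } : St).regs 2 :=
      (Runs.pop_nil _ _ (by simp) (Runs.skip _)).of_eq (by rw [St.upd_g1]) (by omega)
    have h2 : Runs pre2 ({ s with g1 := ([] : List Bool) } : St).regs ({ s with g1 := ([] : List Bool) } : St).regs 1 := Runs.loop_nil _ _ rfl
    refine (Runs.loop_true hk hb h2).of_eq ?_ (by simp)
    cases s; simp only at hg; subst hg; rfl
  | true :: b :: w, s, hw, hg, ht2 => by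
    have hk : s.regs R.g1 = true :: b :: w := hw
    have hk' : (Function.update s.regs R.g1 (b :: w)) R.g1 = b :: w := by simp
    have hb : Runs (Com.pop R.g1 (Com.push R.t true) (Com.push R.t false) Com.skip) (Function.update s.regs R.g1 (b :: w))
        ({ s with g1 := w, t := b :: s.t } : St).regs 3 := by
      cases b
      · exact (Runs.pop_false' _ _ hk' (by rw [Function.update_idem]) (Runs.push _ _ _)).of_eq (by rw [St.upd_g1, St.upd_t]; rfl) le_rfl
      · exact (Runs.pop_true' _ _ hk' (by rw [Function.update_idem]) (Runs.push _ _ _)).of_eq (by rw [St.upd_g1, St.upd_t]; rfl) le_rfl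
    have ih := runs_pre2 w ({ s with g1 := w, t := b :: s.t } : St) rfl hg ht2
    refine (Runs.loop_true hk hb ih).of_eq ?_ ?_
    · simp only [pre2M, List.reverse_cons, List.append_assoc, List.singleton_append]
    · simp only [List.length_cons]; omega
  | false :: w, s, hw, hg, ht2 => by
    have hk : s.regs R.g1 = false :: w := hw
    have hb : Runs (Com.move R.g1 R.g2 R.t2) (Function.update s.regs R.g1 w) ({ s with g1 := ([] : List Bool), g2 := w } : St).regs
        (6 * w.length + 2) := by
      have hm := runs_move (a := R.g1) (b := R.g2) (t := R.t2) (by decide) (by decide) (by decide) ({ s with g1 := w } : St).regs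
        (by simpa using ht2)
      rw [St.upd_g1]
      refine hm.of_eq ?_ (by simp)
      rw [St.upd_g1, St.upd_g2]; simp [hg]
    have h2 : Runs pre2 ({ s with g1 := ([] : List Bool), g2 := w } : St).regs ({ s with g1 := ([] : List Bool), g2 := w } : St).regs 1 :=
      Runs.loop_nil _ _ rfl
    refine (Runs.loop_false hk hb h2).of_eq ?_ ?_
    · simp [pre2M]
    · simp only [List.length_cons]; omega

/-- Read `1ᵐ 0`: count the ones into `mU`, move the rest (the gate tokens) to `g`. [folklore] -/
def pre3 : Com R := Com.loop .g2 (Com.push .mU true) (Com.move .g2 .g .t)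

/-- `pre3` runs to the model `pre1M` (same loop on other registers; `g`, `t` empty). [folklore] -/
theorem runs_pre3 : ∀ (w : List Bool) (s : St), s.g2 = w → s.g = [] → s.t = [] →
    Runs pre3 s.regs { s with g2 := [], mU := List.replicate (pre1M w).1 true ++ s.mU, g := (pre1M w).2 }.regs (6 * w.length + 3)
  | [], s, hw, hg, _ => by
    refine (Runs.loop_nil _ _ (show s.regs R.g2 = [] from hw)).of_eq ?_ (by omega)
    cases s; simp only at hw hg; subst hw; subst hg; rfl
  | true :: w, s, hw, hg, ht => by
    have hk : s.regs R.g2 = true :: w := hw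
    have hb : Runs (Com.push R.mU true) (Function.update s.regs R.g2 w) ({ s with g2 := w, mU := true :: s.mU } : St).regs 1 :=
      (Runs.push _ _ _).of_eq (by rw [St.upd_g2, St.upd_mU]; rfl) le_rfl
    have ih := runs_pre3 w ({ s with g2 := w, mU := true :: s.mU } : St) rfl hg ht
    refine (Runs.loop_true hk hb ih).of_eq ?_ ?_
    · simp only [pre1M, List.replicate_succ', List.append_assoc, List.singleton_append]
    · simp only [List.length_cons]; omega
  | false :: w, s, hw, hg, ht => by
    have hk : s.regs R.g2 = false :: w := hw
    have hb : Runs (Com.move R.g2 R.g R.t) (Function.update s.regs R.g2 w) ({ s with g2 := ([] : List Bool), g := w } : St).regs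
        (6 * w.length + 2) := by
      have hm := runs_move (a := R.g2) (b := R.g) (t := R.t) (by decide) (by decide) (by decide) ({ s with g2 := w } : St).regs
        (by simpa using ht)
      rw [St.upd_g2]
      refine hm.of_eq ?_ (by simp)
      rw [St.upd_g2, St.upd_g]; simp [hg]
    have h2 : Runs pre3 ({ s with g2 := ([] : List Bool), g := w } : St).regs ({ s with g2 := ([] : List Bool), g := w } : St).regs 1 :=
      Runs.loop_nil _ _ rfl
    refine (Runs.loop_false hk hb h2).of_eq ?_ ?_
    · simp [pre1M]
    · simp only [List.length_cons]; omega

/-! ### Set-up -/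

/-- A countdown loop with the same body on both bits runs on ANY content of `cU` (not only ticks),
under an invariant `P`, with state-dependent costs summed along the iterates. [cite: AroraBarak2009, §1.3] -/
theorem runs_loopCU_any {body : Com R} {f : St → St} {P : St → Prop} {cost : St → ℕ}
    (hf : ∀ s v, f { s with cU := v } = { f s with cU := v }) (hfix : ∀ s, (f s).cU = s.cU)
    (hPc : ∀ s v, P s → P { s with cU := v }) (hPf : ∀ s, P s → P (f s))
    (hcost : ∀ s v, cost { s with cU := v } = cost s)
    (hbody : ∀ s, P s → Runs body s.regs (f s).regs (cost s)) :
    ∀ (w : List Bool) (s : St), s.cU = w → P s →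
      Runs (loopCU body) s.regs { f^[w.length] s with cU := [] }.regs (((List.range w.length).map fun i => cost (f^[i] s) + 2).sum + 1)
  | [], s, hs, _ => by
    refine (Runs.loop_nil _ _ (show s.regs R.cU = [] from hs)).of_eq ?_ (by simp)
    rw [List.length_nil, Function.iterate_zero, id]
    cases s; simp only at hs; subst hs; rfl
  | b :: w, s, hs, hP => by
    have hk : s.regs R.cU = b :: w := hs
    have hb := hbody { s with cU := w } (hPc _ _ hP)
    rw [← St.upd_cU, hcost] at hb
    have hih := runs_loopCU_any hf hfix hPc hPf hcost hbody w (f { s with cU := w }) (by rw [hfix]) (hPf _ (hPc _ _ hP))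
    have heq : ({ f^[w.length] (f { s with cU := w }) with cU := [] } : St) = { f^[(b :: w).length] s with cU := [] } := by
      rw [← Function.iterate_succ_apply, iterate_set_cU hf, set_cU_set_cU, List.length_cons]
    have hc : ∀ i, cost (f^[i] (f { s with cU := w })) = cost (f^[i + 1] s) := by
      intro i; rw [← Function.iterate_succ_apply, iterate_set_cU hf, hcost]
    have hsum : cost s + 2 + (((List.range w.length).map fun i => cost (f^[i] (f { s with cU := w })) + 2).sum + 1) =
        ((List.range (b :: w).length).map fun i => cost (f^[i] s) + 2).sum + 1 := by
      simp only [hc, List.length_cons, List.range_succ_eq_map, List.map_cons, List.map_map, List.sum_cons, Function.iterate_zero, id,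
        Function.comp_def]
      ring
    cases b
    · exact (Runs.loop_false hk hb hih).of_eq (congrArg St.regs heq) (le_of_eq hsum)
    · exact (Runs.loop_true hk hb hih).of_eq (congrArg St.regs heq) (le_of_eq hsum)

/-- A sum over `List.range` is bounded by the length times a uniform bound. [folklore] -/
theorem sum_map_range_le {n B : ℕ} {g : ℕ → ℕ} (h : ∀ i, i < n → g i ≤ B) : ((List.range n).map g).sum ≤ n * B := by
  induction n with
  | zero => simp
  | succ n ih =>
    rw [List.range_succ, List.map_append, List.sum_append, List.map_singleton, List.sum_singleton, Nat.succ_mul]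
    exact Nat.add_le_add (ih fun i hi => h i (Nat.lt_succ_of_lt hi)) (h n (Nat.lt_succ_self n))

/-- The countdown loop on any content of `cU` with a uniform cost bound under the invariant. [cite: AroraBarak2009, §1.3] -/
theorem runs_loopCU_anyC {body : Com R} {f : St → St} {P : St → Prop} {C : ℕ}
    (hf : ∀ s v, f { s with cU := v } = { f s with cU := v }) (hfix : ∀ s, (f s).cU = s.cU)
    (hPc : ∀ s v, P s → P { s with cU := v }) (hPf : ∀ s, P s → P (f s))
    (hbody : ∀ s, P s → Runs body s.regs (f s).regs C) (w : List Bool) (s : St) (hs : s.cU = w) (hP : P s) :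
    Runs (loopCU body) s.regs { f^[w.length] s with cU := [] }.regs (w.length * (C + 2) + 1) :=
  (runs_loopCU_any (cost := fun _ => C) hf hfix hPc hPf (fun _ _ => rfl) hbody w s hs hP).of_eq rfl
    (Nat.add_le_add_right (sum_map_range_le fun _ _ => le_rfl) 1)

/-- `NU := mU ++ nU` (all ones: `1ᴺ`). [folklore] -/
def mkNU : Com R := Com.copy .nU .NU .t .t2 ;; Com.copy .mU .NU .t .t2

/-- `mkNU` runs. [folklore] -/
theorem runs_mkNU (s : St) (ht : s.t = []) (ht2 : s.t2 = []) :
    Runs mkNU s.regs { s with NU := s.mU ++ (s.nU ++ s.NU) }.regs (10 * s.nU.length + 10 * s.mU.length + 6) := by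
  have e1 : Runs (Com.copy R.nU R.NU R.t R.t2) s.regs ({ s with NU := s.nU ++ s.NU } : St).regs (10 * s.nU.length + 3) :=
    (runs_copy (a := R.nU) (b := R.NU) (t := R.t) (u := R.t2) (by decide) (by decide) (by decide) (by decide) (by decide) (by decide)
      s.regs (by simpa using ht) (by simpa using ht2)).of_eq (by rw [St.upd_NU]; rfl) le_rfl
  have e2 : Runs (Com.copy R.mU R.NU R.t R.t2) ({ s with NU := s.nU ++ s.NU } : St).regs ({ s with NU := s.mU ++ (s.nU ++ s.NU) } : St).regs
      (10 * s.mU.length + 3) :=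
    (runs_copy (a := R.mU) (b := R.NU) (t := R.t) (u := R.t2) (by decide) (by decide) (by decide) (by decide) (by decide) (by decide)
      ({ s with NU := s.nU ++ s.NU } : St).regs (by simpa using ht) (by simpa using ht2)).of_eq (by rw [St.upd_NU]; rfl) le_rfl
  exact (e1.seq e2).of_eq rfl (by omega)

/-- `x := bin (|cU| + x)` by repeated increments: the counting loop. [cite: KnuthTAOCP2, §4.3.1] -/
def countLoop : Com R := loopCU (incR .x .t .fl)

/-- The counting loop runs (numeral canonical, `t`, `fl` empty). [cite: KnuthTAOCP2, §4.3.1] -/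
theorem runs_countLoop (w : List Bool) (s : St) (hcU : s.cU = w) (c : ℕ) (hx : s.x = encodeNat c) (ht : s.t = []) (hfl : s.fl = []) :
    Runs countLoop s.regs { s with x := encodeNat (c + w.length), cU := [] }.regs (w.length * (9 * (c + w.length) + 11) + 1) := by
  have key := runs_loopCU_any (body := incR .x .t .fl)
    (f := fun s : St => { s with x := encodeNat (decodeNat s.x + 1) })
    (P := fun s : St => (∃ c, s.x = encodeNat c) ∧ s.t = [] ∧ s.fl = [])
    (cost := fun s : St => 9 * s.x.length + 9)
    (fun _ _ => rfl) (fun _ => rfl) (fun _ _ h => h) (fun s ⟨⟨c, hc⟩, h1, h2⟩ => ⟨⟨_, rfl⟩, h1, h2⟩) (fun _ _ => rfl)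
    (fun s' ⟨⟨c', hc'⟩, h1, h2⟩ => by
      have e := runs_incR (ctr := R.x) (tmp := R.t) (flg := R.fl) (by decide) (by decide) (by decide) c' s'.regs hc' h1 h2
      rw [St.upd_x] at e
      refine e.of_eq ?_ (by simp [hc'])
      simp [hc', decode_encodeNat])
    w s hcU ⟨⟨c, hx⟩, ht, hfl⟩
  have hit : ∀ i, (fun s : St => { s with x := encodeNat (decodeNat s.x + 1) })^[i] s = { s with x := encodeNat (c + i) } := by
    intro i; induction i with
    | zero => rw [Function.iterate_zero, id]; show s = { s with x := encodeNat c }; rw [← hx]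
    | succ i ih => rw [Function.iterate_succ_apply', ih]; simp [decode_encodeNat, Nat.add_assoc]
  rw [hit] at key
  refine key.of_eq rfl (Nat.add_le_add_right (sum_map_range_le fun i hi => ?_) 1)
  rw [hit]
  have := TokConv.length_encodeNat_le (c + i)
  simp only; omega

/-- `x := bin (N + 1)` where `N = |NU|`: load the countdown, count, one more. [cite: KnuthTAOCP2, §4.3.1] -/
def mkX : Com R := Com.copy .NU .cU .t .t2 ;; countLoop ;; incR .x .t .fl

/-- `mkX` runs (from `x = cU = []`). [folklore] -/
theorem runs_mkX (s : St) (N : ℕ) (hNU : s.NU = List.replicate N true) (hx : s.x = []) (hcU : s.cU = []) (ht : s.t = [])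
    (ht2 : s.t2 = []) (hfl : s.fl = []) :
    Runs mkX s.regs { s with x := encodeNat (N + 1), cU := [] }.regs (10 * N + 3 + (N * (9 * N + 11) + 1) + (9 * N + 18)) := by
  have e1 : Runs (Com.copy R.NU R.cU R.t R.t2) s.regs ({ s with cU := s.NU } : St).regs (10 * N + 3) :=
    (runs_copy (a := R.NU) (b := R.cU) (t := R.t) (u := R.t2) (by decide) (by decide) (by decide) (by decide) (by decide) (by decide)
      s.regs (by simpa using ht) (by simpa using ht2)).of_eq (by rw [St.upd_cU]; simp [hcU]) (by simp [hNU])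
  have e2 := runs_countLoop s.NU ({ s with cU := s.NU } : St) rfl 0 (by rw [St.x]; exact hx) ht hfl
  have e3 := runs_incR (ctr := R.x) (tmp := R.t) (flg := R.fl) (by decide) (by decide) (by decide) (0 + s.NU.length)
    ({ s with x := encodeNat (0 + s.NU.length), cU := ([] : List Bool) } : St).regs rfl (by simpa using ht) (by simpa using hfl)
  rw [St.upd_x] at e3
  refine (e1.seq (e2.seq e3)).of_eq ?_ ?_
  · rw [hNU, List.length_replicate, Nat.zero_add]
  · have := TokConv.length_encodeNat_le (0 + N)
    rw [hNU, List.length_replicate] at *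
    simp only [Nat.zero_add] at *
    omega

/-- `LU := 1^{|x|}` through the countdown. [folklore] -/
def mkLU : Com R := Com.copy .x .cU .t .t2 ;; loopCU (Com.push .LU true)

/-- `mkLU` runs (from `LU = cU = []`). [folklore] -/
theorem runs_mkLU (s : St) (hLU : s.LU = []) (hcU : s.cU = []) (ht : s.t = []) (ht2 : s.t2 = []) :
    Runs mkLU s.regs { s with LU := List.replicate s.x.length true }.regs (10 * s.x.length + 3 + (s.x.length * 3 + 1)) := by
  have e1 : Runs (Com.copy R.x R.cU R.t R.t2) s.regs ({ s with cU := s.x } : St).regs (10 * s.x.length + 3) :=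
    (runs_copy (a := R.x) (b := R.cU) (t := R.t) (u := R.t2) (by decide) (by decide) (by decide) (by decide) (by decide) (by decide)
      s.regs (by simpa using ht) (by simpa using ht2)).of_eq (by rw [St.upd_cU]; simp [hcU]) le_rfl
  have e2 := runs_loopCU_any (body := Com.push .LU true) (f := fun s : St => { s with LU := true :: s.LU }) (P := fun _ => True)
    (cost := fun _ => 1) (fun _ _ => rfl) (fun _ => rfl) (fun _ _ _ => trivial) (fun _ _ => trivial) (fun _ _ => rfl)
    (fun s _ => (Runs.push R.LU true s.regs).of_eq (by rw [St.upd_LU]; rfl) le_rfl) s.x ({ s with cU := s.x } : St) rfl trivial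
  have hit : ∀ (k : ℕ) (s : St), (fun s : St => { s with LU := true :: s.LU })^[k] s = { s with LU := List.replicate k true ++ s.LU } := by
    intro k; induction k with
    | zero => intro s; rfl
    | succ k ih => intro s; rw [Function.iterate_succ_apply', ih, List.replicate_succ]; rfl
  rw [hit] at e2
  refine (e1.seq e2).of_eq ?_ ?_
  · rw [hLU, List.append_nil, ← hcU]
  · refine Nat.add_le_add_left (Nat.add_le_add_right ((sum_map_range_le fun i _ => le_rfl).trans (le_of_eq ?_)) 1) _
    ring

/-- `SU := SU ++ SU` once: the doubling step. [folklore] -/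
def dbl : Com R := Com.copy .SU .t3 .t .t2 ;; Com.move .t3 .SU .t

/-- `dbl` runs (`t`, `t2`, `t3` empty). [folklore] -/
theorem runs_dbl (s : St) (ht : s.t = []) (ht2 : s.t2 = []) (ht3 : s.t3 = []) :
    Runs dbl s.regs { s with SU := s.SU ++ s.SU }.regs (16 * s.SU.length + 5) := by
  have e1 : Runs (Com.copy R.SU R.t3 R.t R.t2) s.regs ({ s with t3 := s.SU } : St).regs (10 * s.SU.length + 3) :=
    (runs_copy (a := R.SU) (b := R.t3) (t := R.t) (u := R.t2) (by decide) (by decide) (by decide) (by decide) (by decide) (by decide)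
      s.regs (by simpa using ht) (by simpa using ht2)).of_eq (by rw [St.upd_t3]; simp [ht3]) le_rfl
  have e2 := runs_move (a := R.t3) (b := R.SU) (t := R.t) (by decide) (by decide) (by decide) ({ s with t3 := s.SU } : St).regs (by simpa using ht)
  rw [St.upd_t3, St.upd_SU] at e2
  refine (e1.seq e2).of_eq ?_ (by simp; omega)
  funext r; cases r <;> first | rfl | simp [ht3]

/-- `SU := 1^{2^L}`: one tick, doubled `L = |LU|` times. [folklore] -/
def mkSU : Com R := Com.push .SU true ;; Com.copy .LU .cU .t .t2 ;; loopCU dbl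

/-- `mkSU` runs (from `SU = cU = []`). [folklore] -/
theorem runs_mkSU (s : St) (L : ℕ) (hLU : s.LU = List.replicate L true) (hSU : s.SU = []) (hcU : s.cU = []) (ht : s.t = [])
    (ht2 : s.t2 = []) (ht3 : s.t3 = []) :
    Runs mkSU s.regs { s with SU := List.replicate (2 ^ L) true }.regs (1 + (10 * L + 3) + (L * (16 * 2 ^ L + 7) + 1)) := by
  have e0 : Runs (Com.push R.SU true) s.regs ({ s with SU := [true] } : St).regs 1 := (Runs.push _ _ _).of_eq (by rw [St.upd_SU, St.regs_SU, hSU]) le_rfl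
  have e1 : Runs (Com.copy R.LU R.cU R.t R.t2) ({ s with SU := [true] } : St).regs ({ s with SU := [true], cU := s.LU } : St).regs
      (10 * s.LU.length + 3) :=
    (runs_copy (a := R.LU) (b := R.cU) (t := R.t) (u := R.t2) (by decide) (by decide) (by decide) (by decide) (by decide) (by decide)
      ({ s with SU := [true] } : St).regs (by simpa using ht) (by simpa using ht2)).of_eq (by rw [St.upd_cU]; simp [hcU]) le_rfl
  have e2 := runs_loopCU_any (body := dbl) (f := fun s : St => { s with SU := s.SU ++ s.SU })
    (P := fun s : St => s.t = [] ∧ s.t2 = [] ∧ s.t3 = []) (cost := fun s : St => 16 * s.SU.length + 5)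
    (fun _ _ => rfl) (fun _ => rfl) (fun _ _ h => h) (fun _ h => h) (fun _ _ => rfl) (fun s ⟨h1, h2, h3⟩ => runs_dbl s h1 h2 h3)
    s.LU ({ s with SU := [true], cU := s.LU } : St) rfl ⟨ht, ht2, ht3⟩
  have hit : ∀ (k : ℕ) (s : St), (fun s : St => { s with SU := s.SU ++ s.SU })^[k] s =
      { s with SU := (List.replicate (2 ^ k) s.SU).flatten } := by
    intro k; induction k with
    | zero => intro s; simp
    | succ k ih =>
      intro s; rw [Function.iterate_succ_apply', ih, pow_succ, Nat.mul_two, List.replicate_add, List.flatten_append]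
  rw [hit] at e2
  have hrep : ∀ k, (List.replicate k [true]).flatten = List.replicate k true := by
    intro k; induction k with
    | zero => rfl
    | succ k ih => rw [List.replicate_succ, List.flatten_cons, ih]; rfl
  have hS : ((List.range s.LU.length).map fun i => 16 * ((fun s : St => { s with SU := s.SU ++ s.SU })^[i]
      ({ s with SU := [true], cU := s.LU } : St)).SU.length + 5 + 2).sum ≤ L * (16 * 2 ^ L + 7) := by
    rw [hLU, List.length_replicate]
    refine sum_map_range_le fun i hi => ?_
    rw [hit]
    simp only [hrep, List.length_replicate]
    have : 2 ^ i ≤ 2 ^ L := Nat.pow_le_pow_right (by norm_num) hi.le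
    omega
  refine (e0.seq (e1.seq e2)).of_eq ?_ ?_
  · funext r; cases r <;> simp [hrep, hLU, hcU]
  · rw [hLU, List.length_replicate] at hS ⊢
    omega

/-- The constants of the gate loop: `k1 := bin 1`, `sB := bin 2`, `s1`, `s2`, `sfU := 1³`, `lc := 1ᴸ`. [folklore] -/
def mkConsts : Com R := Com.push .k1 true ;; pushList .sB [true, false] ;; mkStages ;; pushList .sfU [true, true, true] ;; Com.copy .LU .lc .t .t2

/-- `bin 2 = [0, 1]`. [folklore] -/
theorem encodeNat_two : encodeNat 2 = [false, true] := by decide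

/-- `mkConsts` runs (fresh registers). [folklore] -/
theorem runs_mkConsts (s : St) (hE : Env L N s) (hk1 : s.k1 = []) (hsB : s.sB = []) (hs1 : s.s1 = []) (hs2 : s.s2 = [])
    (hsfU : s.sfU = []) (hlc : s.lc = []) :
    Runs mkConsts s.regs
      { s with k1 := encodeNat 1, sB := encodeNat 2, s1 := encodeNat 3, s2 := encodeNat 4, sfU := [true, true, true], lc := List.replicate L true }.regs
      (10 * L + 170) := by
  have e1 : Runs (Com.push R.k1 true) s.regs ({ s with k1 := encodeNat 1 } : St).regs 1 :=
    (Runs.push _ _ _).of_eq (by rw [St.upd_k1, St.regs_k1, hk1]; rfl) le_rfl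
  have e2 : Runs (pushList R.sB [true, false]) ({ s with k1 := encodeNat 1 } : St).regs ({ s with k1 := encodeNat 1, sB := encodeNat 2 } : St).regs 2 :=
    (runs_pushList R.sB [true, false] _).of_eq (by rw [St.upd_sB, St.regs_sB, encodeNat_two]; simp [hsB]) le_rfl
  have e3 := runs_mkStages ({ s with k1 := encodeNat 1, sB := encodeNat 2 } : St) ⟨hE.hLU, hE.hNU, hE.ht, hE.ht2, hE.hfl⟩ 2 rfl
  have e4 : Runs (pushList R.sfU [true, true, true]) ({ s with k1 := encodeNat 1, sB := encodeNat 2, s1 := encodeNat 3, s2 := encodeNat 4 } : St).regs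
      ({ s with k1 := encodeNat 1, sB := encodeNat 2, s1 := encodeNat 3, s2 := encodeNat 4, sfU := [true, true, true] } : St).regs 3 :=
    (runs_pushList R.sfU [true, true, true] _).of_eq (by rw [St.upd_sfU, St.regs_sfU]; simp [hsfU]) le_rfl
  have e5 : Runs (Com.copy R.LU R.lc R.t R.t2)
      ({ s with k1 := encodeNat 1, sB := encodeNat 2, s1 := encodeNat 3, s2 := encodeNat 4, sfU := [true, true, true] } : St).regs
      ({ s with k1 := encodeNat 1, sB := encodeNat 2, s1 := encodeNat 3, s2 := encodeNat 4, sfU := [true, true, true], lc := List.replicate L true } : St).regs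
      (10 * L + 3) :=
    (runs_copy (a := R.LU) (b := R.lc) (t := R.t) (u := R.t2) (by decide) (by decide) (by decide) (by decide) (by decide) (by decide) _
      (by simpa using hE.ht) (by simpa using hE.ht2)).of_eq (by rw [St.upd_lc, St.regs_LU, St.regs_lc]; simp [hlc, hE.hLU]) (by simp [hE.hLU])
  refine (e1.seq (e2.seq (e3.seq (e4.seq e5)))).of_eq rfl ?_
  have h2 : (encodeNat 2).length = 2 := by decide
  simp only [hs1, hs2, List.length_nil, h2]
  omega

/-! ### The boundary layers -/

/-- The hop text from counter value `i₀`: `CZ(numF (i₀ + j) ++ u, numF (i₀ + j) ++ v)`, `j < k`. [folklore] -/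
def hopTextFrom (L i₀ k : ℕ) (u v : List Bool) : List Bool :=
  (List.range k).flatMap fun j => czText (numF L (i₀ + j) ++ u) (numF L (i₀ + j) ++ v)

/-- `hopTextFrom` with one more line. [folklore] -/
theorem hopTextFrom_succ (L i₀ k : ℕ) (u v : List Bool) :
    hopTextFrom L i₀ (k + 1) u v = hopTextFrom L i₀ k u v ++ czText (numF L (i₀ + k) ++ u) (numF L (i₀ + k) ++ v) := by
  rw [hopTextFrom, List.range_succ, List.flatMap_append, List.flatMap_singleton]; rfl

/-- `numF` along additions. [folklore] -/
theorem numF_add (L i k : ℕ) : numF L (i + k) = (TokConv.ib true)^[k] (numF L i) := by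
  rw [numF, numF, ← Function.iterate_add_apply, Nat.add_comm]

/-- Iterating the hop body from counter value `i₀`. [folklore] -/
theorem hopBodyM_iterate_from {sa sb : R} (ha : StageReg sa) (hb : StageReg sb) (L i₀ : ℕ) :
    ∀ (k : ℕ) (s : St), s.iF = numF L i₀ →
      (hopBodyM sa sb)^[k] s = { s with o := (hopTextFrom L i₀ k (s.regs sa) (s.regs sb)).reverse ++ s.o, iF := numF L (i₀ + k) }
  | 0, s, h => by simp [hopTextFrom, ← h]
  | k + 1, s, h => by
    have hao := ha.1; have hai := ha.2.2.1; have hbo := hb.1; have hbi := hb.2.2.1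
    rw [Function.iterate_succ_apply', hopBodyM_iterate_from ha hb L i₀ k s h, hopBodyM, hopTextFrom_succ, ← Nat.add_assoc, numF_succ]
    have h1 : ∀ (x y : List Bool), ({ s with o := x, iF := y } : St).regs sa = s.regs sa := by
      intro x y; cases sa <;> first | rfl | exact absurd rfl hao | exact absurd rfl hai
    have h2 : ∀ (x y : List Bool), ({ s with o := x, iF := y } : St).regs sb = s.regs sb := by
      intro x y; cases sb <;> first | rfl | exact absurd rfl hbo | exact absurd rfl hbi
    simp only [h1, h2, List.reverse_append, List.append_assoc]

/-- **A hop loop from counter value `i₀` over an arbitrary countdown**: prints `hopTextFrom`.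
[cite: BremnerJozsaShepherdPRSA2011, Thm. 1 (proof, Fig. 1)] -/
theorem runs_hopLoop_from {sa sb : R} (ha : StageReg sa) (hb : StageReg sb) (s : St) (L i₀ B : ℕ) (w : List Bool)
    (hcU : s.cU = w) (hiF : s.iF = numF L i₀) (ht : s.t = []) (hf : s.fl = []) (hsa : (s.regs sa).length ≤ B) (hsb : (s.regs sb).length ≤ B) :
    Runs (loopCU (hopBody sa sb)) s.regs
      { s with o := (hopTextFrom L i₀ w.length (s.regs sa) (s.regs sb)).reverse ++ s.o, iF := numF L (i₀ + w.length), cU := [] }.regs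
      (w.length * (29 * L + 20 * B + 47) + 1) := by
  have hao := ha.1; have hai := ha.2.2.1; have hac := ha.2.2.2.1
  have hbo := hb.1; have hbi := hb.2.2.1; have hbc := hb.2.2.2.1
  have e := runs_loopCU_any (body := hopBody sa sb) (f := hopBodyM sa sb)
    (P := fun x : St => x.t = [] ∧ x.fl = [] ∧ x.iF.length = L ∧ x.regs sa = s.regs sa ∧ x.regs sb = s.regs sb)
    (cost := fun x : St => 10 * (x.iF.length + (x.regs sa).length) + 10 * (x.iF.length + (x.regs sb).length) + 9 * x.iF.length + 45)
    (hopBodyM_set_cU ha hb) (fun _ => rfl)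
    (fun x v ⟨h1, h2, h3, h4, h5⟩ => ⟨h1, h2, h3,
      by rw [← h4]; cases sa <;> first | rfl | exact absurd rfl hac,
      by rw [← h5]; cases sb <;> first | rfl | exact absurd rfl hbc⟩)
    (fun x ⟨h1, h2, h3, h4, h5⟩ => ⟨h1, h2, by rw [hopBodyM, length_ib]; exact h3,
      by rw [← h4, hopBodyM]; cases sa <;> first | rfl | exact absurd rfl hao | exact absurd rfl hai,
      by rw [← h5, hopBodyM]; cases sb <;> first | rfl | exact absurd rfl hbo | exact absurd rfl hbi⟩)
    (fun x v => by
      have e1 : ({ x with cU := v } : St).regs sa = x.regs sa := by cases sa <;> first | rfl | exact absurd rfl hac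
      have e2 : ({ x with cU := v } : St).regs sb = x.regs sb := by cases sb <;> first | rfl | exact absurd rfl hbc
      simp only [e1, e2])
    (fun x ⟨h1, h2, _, _, _⟩ => runs_hopBody ha hb x h1 h2)
    w s hcU ⟨ht, hf, by rw [hiF, length_numF], rfl, rfl⟩
  rw [hopBodyM_iterate_from ha hb L i₀ w.length s hiF] at e
  refine e.of_eq rfl (Nat.add_le_add_right (sum_map_range_le fun i _ => ?_) 1)
  rw [hopBodyM_iterate_from ha hb L i₀ i s hiF]
  have e1 : ∀ (x y : List Bool), ({ s with o := x, iF := y } : St).regs sa = s.regs sa := by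
    intro x y; cases sa <;> first | rfl | exact absurd rfl hao | exact absurd rfl hai
  have e2 : ∀ (x y : List Bool), ({ s with o := x, iF := y } : St).regs sb = s.regs sb := by
    intro x y; cases sb <;> first | rfl | exact absurd rfl hbo | exact absurd rfl hbi
  simp only [e1, e2, length_numF]
  omega

/-- Text of the initial layer, input part: `CZ(bin i, numF i ++ v)` for `i < n`. [cite: BremnerJozsaShepherdPRSA2011, Thm. 1 (proof)] -/
def initAText (L n : ℕ) (v : List Bool) : List Bool := (List.range n).flatMap fun i => czText (encodeNat i) (numF L i ++ v)

/-- `initAText` with one more line. [folklore] -/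
theorem initAText_succ (L n : ℕ) (v : List Bool) :
    initAText L (n + 1) v = initAText L n v ++ czText (encodeNat n) (numF L n ++ v) := by
  rw [initAText, List.range_succ, List.flatMap_append, List.flatMap_singleton]; rfl

/-- Body of the input part of the initial layer: print, count in binary and in fixed width. [folklore] -/
def initABody : Com R := emitCZ [.iC] [.iF, .sB] ;; incR .iC .t .fl ;; incF .iF

/-- Model of `initABody`. [folklore] -/
def initABodyM (s : St) : St :=
  { s with o := (czText s.iC (s.iF ++ s.sB)).reverse ++ s.o, iC := encodeNat (decodeNat s.iC + 1), iF := TokConv.ib true s.iF }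

/-- `initABody` runs to its model (counter canonical). [folklore] -/
theorem runs_initABody (s : St) (c : ℕ) (hiC : s.iC = encodeNat c) (ht : s.t = []) (hf : s.fl = []) :
    Runs initABody s.regs (initABodyM s).regs (10 * s.iC.length + 10 * (s.iF.length + s.sB.length) + 38 + (9 * s.iC.length + 9) + (9 * s.iF.length + 5)) := by
  have e1 := runs_emitCZ (P := [.iC]) (Q := [.iF, .sB]) (by simp) (by simp) (by simp) (by simp) s ht
  simp only [cat_cons, cat_nil, List.append_nil, St.regs_iC, St.regs_iF, St.regs_sB] at e1
  have e2 := runs_incR (ctr := R.iC) (tmp := R.t) (flg := R.fl) (by decide) (by decide) (by decide) c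
    ({ s with o := (czText s.iC (s.iF ++ s.sB)).reverse ++ s.o } : St).regs (by simpa using hiC) (by simpa using ht) (by simpa using hf)
  rw [St.upd_iC] at e2
  have e3 := runs_incF (r := R.iF) (by decide) (by decide)
    ({ s with o := (czText s.iC (s.iF ++ s.sB)).reverse ++ s.o, iC := encodeNat (c + 1) } : St) ht hf
  rw [St.upd_iF] at e3
  refine (e1.seq (e2.seq e3)).of_eq ?_ ?_
  · simp [initABodyM, hiC, decode_encodeNat]
  · simp only [List.length_append, List.length_cons, List.length_nil, St.regs_iF, hiC]; omega

/-- Iterating the body of the input part. [folklore] -/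
theorem initABodyM_iterate (L : ℕ) : ∀ (k : ℕ) (s : St), s.iC = [] → s.iF = List.replicate L false →
    initABodyM^[k] s = { s with o := (initAText L k s.sB).reverse ++ s.o, iC := encodeNat k, iF := numF L k }
  | 0, s, h1, h2 => by rw [Function.iterate_zero, id]; cases s; simp only at h1 h2; subst h1; subst h2; rfl
  | k + 1, s, h1, h2 => by
    rw [Function.iterate_succ_apply', initABodyM_iterate L k s h1 h2, initABodyM, initAText_succ, numF_succ]
    simp [decode_encodeNat, List.reverse_append]

/-- **The input part of the initial layer**: reset the counters, count `n` down printing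
`CZ(i, pos 2 i)`. [cite: BremnerJozsaShepherdPRSA2011, Thm. 1 (proof)] -/
def initA : Com R := mkZeroF ;; Com.clear .iC ;; Com.copy .nU .cU .t .t2 ;; loopCU initABody

/-- `initA` runs. [cite: BremnerJozsaShepherdPRSA2011, Thm. 1 (proof)] -/
theorem runs_initA (s : St) (n : ℕ) (hE : Env L N s) (hnU : s.nU = List.replicate n true) (hiC : s.iC = []) (hcU : s.cU = []) :
    Runs initA s.regs { s with o := (initAText L n s.sB).reverse ++ s.o, iC := encodeNat n, iF := numF L n, cU := [] }.regs
      (2 * s.iF.length + 13 * L + 7 + (10 * n + 3) + (n * (48 * n + 29 * L + 10 * s.sB.length + 70) + 1)) := by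
  have e1 := runs_mkZeroF s L hE.hLU hE.ht hE.ht2
  have e2 : Runs (Com.clear R.iC) ({ s with iF := List.replicate L false, cU := [] } : St).regs
      ({ s with iF := List.replicate L false, cU := [] } : St).regs 1 :=
    (runs_clear R.iC _).of_eq (by rw [St.upd_iC]; simp [hiC]) (by simp [hiC])
  have e3 : Runs (Com.copy R.nU R.cU R.t R.t2) ({ s with iF := List.replicate L false, cU := [] } : St).regs
      ({ s with iF := List.replicate L false, cU := s.nU } : St).regs (10 * n + 3) :=
    (runs_copy (a := R.nU) (b := R.cU) (t := R.t) (u := R.t2) (by decide) (by decide) (by decide) (by decide) (by decide) (by decide) _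
      (by simpa using hE.ht) (by simpa using hE.ht2)).of_eq (by rw [St.upd_cU]; simp) (by simp [hnU])
  have e4 := runs_loopCU_any (body := initABody) (f := initABodyM)
    (P := fun x : St => (∃ c, x.iC = encodeNat c ∧ c ≤ decodeNat x.iC) ∧ x.t = [] ∧ x.fl = [] ∧ x.iF.length = L ∧ x.sB = s.sB)
    (cost := fun x : St => 10 * x.iC.length + 10 * (x.iF.length + x.sB.length) + 38 + (9 * x.iC.length + 9) + (9 * x.iF.length + 5))
    (fun _ _ => rfl) (fun _ => rfl) (fun x v h => h)
    (fun x ⟨⟨c, hc, _⟩, h1, h2, h3, h4⟩ => ⟨⟨decodeNat x.iC + 1, rfl, by simp [initABodyM, decode_encodeNat]⟩, h1, h2,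
      by rw [initABodyM, length_ib]; exact h3, h4⟩)
    (fun _ _ => rfl) (fun x ⟨⟨c, hc, _⟩, h1, h2, _, _⟩ => runs_initABody x c hc h1 h2)
    s.nU ({ s with iF := List.replicate L false, cU := s.nU } : St) rfl ⟨⟨0, hiC.trans rfl, Nat.zero_le _⟩, hE.ht, hE.hfl, by simp, rfl⟩
  rw [initABodyM_iterate L s.nU.length _ (by simpa using hiC) rfl] at e4
  refine (e1.seq (e2.seq (e3.seq e4))).of_eq ?_ ?_
  · simp [hnU]
  · have hS := sum_map_range_le (n := s.nU.length) (B := 48 * n + 29 * L + 10 * s.sB.length + 70)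
      (g := fun i => 10 * (initABodyM^[i] ({ s with iF := List.replicate L false, cU := s.nU } : St)).iC.length +
        10 * ((initABodyM^[i] ({ s with iF := List.replicate L false, cU := s.nU } : St)).iF.length +
          (initABodyM^[i] ({ s with iF := List.replicate L false, cU := s.nU } : St)).sB.length) + 38 +
        (9 * (initABodyM^[i] ({ s with iF := List.replicate L false, cU := s.nU } : St)).iC.length + 9) +
        (9 * (initABodyM^[i] ({ s with iF := List.replicate L false, cU := s.nU } : St)).iF.length + 5) + 2) (fun i hi => by
        rw [initABodyM_iterate L i _ (by simpa using hiC) rfl]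
        have := TokConv.length_encodeNat_le i
        rw [hnU, List.length_replicate] at hi
        simp only [length_numF]
        omega)
    rw [hnU, List.length_replicate, hcU] at *
    simp only [List.length_nil] at *
    omega

/-- **The ancilla part of the initial layer**: `CZ(pos 1 (n+j), pos 2 (n+j))` for `j < m`, the counter
continuing from `n`. [cite: BremnerJozsaShepherdPRSA2011, Thm. 1 (proof)] -/
def initB : Com R := Com.copy .mU .cU .t .t2 ;; loopCU (hopBody .k1 .sB)

/-- `initB` runs. [cite: BremnerJozsaShepherdPRSA2011, Thm. 1 (proof)] -/
theorem runs_initB (s : St) (n m B : ℕ) (ht : s.t = []) (ht2 : s.t2 = []) (hf : s.fl = []) (hmU : s.mU = List.replicate m true)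
    (hiF : s.iF = numF L n) (hcU : s.cU = []) (hk1 : s.k1.length ≤ B) (hsB : s.sB.length ≤ B) :
    Runs initB s.regs { s with o := (hopTextFrom L n m s.k1 s.sB).reverse ++ s.o, iF := numF L (n + m), cU := [] }.regs
      (10 * m + 3 + (m * (29 * L + 20 * B + 47) + 1)) := by
  have e1 : Runs (Com.copy R.mU R.cU R.t R.t2) s.regs ({ s with cU := s.mU } : St).regs (10 * m + 3) :=
    (runs_copy (a := R.mU) (b := R.cU) (t := R.t) (u := R.t2) (by decide) (by decide) (by decide) (by decide) (by decide) (by decide) _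
      (by simpa using ht) (by simpa using ht2)).of_eq (by rw [St.upd_cU]; simp [hcU]) (by simp [hmU])
  have e2 := runs_hopLoop_from (sa := R.k1) (sb := R.sB) (by unfold StageReg; decide) (by unfold StageReg; decide)
    ({ s with cU := s.mU } : St) L n B s.mU rfl hiF ht hf hk1 hsB
  refine (e1.seq e2).of_eq ?_ (by rw [hmU, List.length_replicate])
  simp [hmU]

/-! ### The final layer -/

/-- The `CZ`s of the final layer: `CZ(pos s_f i, tgt i)` for `i < N` (`tgt 0 = n`, `tgt 1 = n + 1`, else
`pos (s_f+1) i`). [cite: BremnerJozsaShepherdPRSA2011, Thm. 1 (proof) and Def. 3] -/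
def finalCZs (L N : ℕ) (u v nb n1b : List Bool) : List Bool :=
  (List.range N).flatMap fun i => czText (numF L i ++ u) (if i = 0 then nb else if i = 1 then n1b else numF L i ++ v)

/-- Text of the final layer: the `CZ`s, then `Z(n+1)`. [cite: BremnerJozsaShepherdPRSA2011, Thm. 1 (proof) and Def. 3] -/
def finalText (L N : ℕ) (u v nb n1b : List Bool) : List Bool := finalCZs L N u v nb n1b ++ zText n1b

/-- `List.range (k + 2)`. [folklore] -/
theorem range_add_two (k : ℕ) : List.range (k + 2) = 0 :: 1 :: (List.range k).map (· + 2) := by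
  rw [List.range_succ_eq_map, List.range_succ_eq_map, List.map_cons, List.map_map]; rfl

/-- `finalCZs` for `N + 2` lines, in the order the machine prints it. [folklore] -/
theorem finalCZs_add_two (L N : ℕ) (u v nb n1b : List Bool) :
    finalCZs L (N + 2) u v nb n1b = czText (numF L 0 ++ u) nb ++ (czText (numF L 1 ++ u) n1b ++ hopTextFrom L 2 N u v) := by
  rw [finalCZs, range_add_two, List.flatMap_cons, List.flatMap_cons, List.flatMap_map, hopTextFrom]
  congr 1
  congr 1
  congr 1
  funext j
  have h1 : 2 + j ≠ 1 := by omega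
  simp only [Nat.add_comm j 2]
  simp [h1]

/-- `finalCZs` for no line and for one line. [folklore] -/
theorem finalCZs_zero (L : ℕ) (u v nb n1b : List Bool) : finalCZs L 0 u v nb n1b = [] := rfl
/-- `finalCZs` for one line. [folklore] -/
theorem finalCZs_one (L : ℕ) (u v nb n1b : List Bool) : finalCZs L 1 u v nb n1b = czText (numF L 0 ++ u) nb := by
  simp [finalCZs]

/-- **Binary increment on an arbitrary register content** (the same run as `Thm25Asm.runs_incR`,
stated for any `w`: the result is `TokConv.incRes true w`). [cite: KnuthTAOCP2, §4.3.1] -/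
theorem runs_incR_any {ι : Type} [DecidableEq ι] {ctr tmp flg : ι} (hct : ctr ≠ tmp) (hcf : ctr ≠ flg) (htf : tmp ≠ flg) (w : List Bool)
    (R : Regs ι) (hc : R ctr = w) (ht : R tmp = []) (hf : R flg = []) :
    Runs (incR ctr tmp flg) R (Function.update R ctr (TokConv.incRes true w)) (9 * w.length + 9) := by
  have h0 : Runs (Com.push flg true) R (Function.update R flg (flag true)) 1 := Runs.push' (by simp [hf])
  have h1 := Thm25Asm.runs_incLoop hct hcf htf w true (Function.update R flg (flag true)) (by simp [hcf, hc]) (by simp)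
  set R₁ := Function.update (Function.update (Function.update (Function.update R flg (flag true)) ctr []) tmp
    ((TokConv.ib true w).reverse ++ Function.update R flg (flag true) tmp)) flg (flag (TokConv.co true w)) with hR₁
  set R₂ := Function.update (Function.update R₁ flg []) tmp ((TokConv.incRes true w).reverse) with hR₂
  have h2 : Runs (Com.pop flg (Com.push tmp true) Com.skip Com.skip) R₁ R₂ 3 := by
    cases hco : TokConv.co true w
    · have hk : R₁ flg = [] := by simp [R₁, hco]
      refine (Runs.pop_nil _ _ hk (Runs.skip _)).of_eq ?_ (by omega)
      ext i : 1
      simp only [hR₂, Function.update_apply, TokConv.incRes, hco, flag_false, List.append_nil]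
      split_ifs <;> simp_all
    · have hk : R₁ flg = true :: [] := by simp [R₁, hco]
      refine (Runs.pop_true' _ _ hk rfl (Runs.push tmp true _)).of_eq ?_ (by omega)
      ext i : 1
      simp only [hR₂, Function.update_apply, TokConv.incRes, hco, flag_true, List.reverse_append, List.reverse_singleton, List.singleton_append]
      split_ifs <;> simp_all
  have h3 := runs_pour (a := tmp) (b := ctr) hct.symm R₂
  have hR₂tmp : R₂ tmp = (TokConv.incRes true w).reverse := by simp [R₂]
  refine (h0.seq (h1.seq (h2.seq h3))).of_eq ?_ ?_
  · ext i : 1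
    simp only [hR₂, hR₁, Function.update_apply, ht]
    split_ifs <;> simp_all
  · rw [hR₂tmp, List.length_reverse]
    have := TokConv.length_incRes_le true w
    omega

/-- `n1B := nB + 1`. [folklore] -/
def mkN1B : Com R := Com.copy .nB .n1B .t .t2 ;; incR .n1B .t .fl

/-- `mkN1B` runs (`n1B` empty; any content of `nB`). [folklore] -/
theorem runs_mkN1B (s : St) (hn1B : s.n1B = []) (ht : s.t = []) (ht2 : s.t2 = []) (hfl : s.fl = []) :
    Runs mkN1B s.regs { s with n1B := TokConv.incRes true s.nB }.regs (10 * s.nB.length + 3 + (9 * s.nB.length + 9)) := by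
  have e1 : Runs (Com.copy R.nB R.n1B R.t R.t2) s.regs ({ s with n1B := s.nB } : St).regs (10 * s.nB.length + 3) :=
    (runs_copy (a := R.nB) (b := R.n1B) (t := R.t) (u := R.t2) (by decide) (by decide) (by decide) (by decide) (by decide) (by decide) _
      (by simpa using ht) (by simpa using ht2)).of_eq (by rw [St.upd_n1B]; simp [hn1B]) (by simp)
  have e2 := runs_incR_any (ctr := R.n1B) (tmp := R.t) (flg := R.fl) (by decide) (by decide) (by decide) s.nB ({ s with n1B := s.nB } : St).regs
    rfl (by simpa using ht) (by simpa using hfl)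
  rw [St.upd_n1B] at e2
  exact (e1.seq e2).of_eq rfl le_rfl

/-- One final `CZ` onto the target register `tgt`, counting. [folklore] -/
def finalBody0 (tgt : R) : Com R := emitCZ [.iF, .sB] [tgt] ;; incF .iF

/-- Model of `finalBody0`. [folklore] -/
def finalBody0M (tgt : R) (s : St) : St := { s with o := (czText (s.iF ++ s.sB) (s.regs tgt)).reverse ++ s.o, iF := TokConv.ib true s.iF }

/-- `finalBody0` runs (`tgt` one of `nB`, `n1B`). [folklore] -/
theorem runs_finalBody0 {tgt : R} (htg : tgt = .nB ∨ tgt = .n1B) (s : St) (ht : s.t = []) (hf : s.fl = []) :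
    Runs (finalBody0 tgt) s.regs (finalBody0M tgt s).regs (10 * (s.iF.length + s.sB.length) + 10 * (s.regs tgt).length + 38 + (9 * s.iF.length + 5)) := by
  have hto : R.o ∉ [tgt] := by rcases htg with rfl | rfl <;> decide
  have htt : R.t ∉ [tgt] := by rcases htg with rfl | rfl <;> decide
  have e1 := runs_emitCZ (P := [.iF, .sB]) (Q := [tgt]) (by simp) (by simp) hto htt s ht
  simp only [cat_cons, cat_nil, List.append_nil, St.regs_iF, St.regs_sB] at e1
  have e2 := runs_incF (r := R.iF) (by decide) (by decide) ({ s with o := (czText (s.iF ++ s.sB) (s.regs tgt)).reverse ++ s.o } : St) ht hf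
  rw [St.upd_iF] at e2
  refine (e1.seq e2).of_eq rfl ?_
  simp only [List.length_append, List.length_cons, List.length_nil, St.regs_iF]; omega

/-- The first two final `CZ`s (onto `n` and `n + 1`), each only if the countdown has a tick. [folklore] -/
def final01 : Com R :=
  Com.pop .cU (finalBody0 .nB) (finalBody0 .nB) Com.skip ;; Com.pop .cU (finalBody0 .n1B) (finalBody0 .n1B) Com.skip

/-- **The `CZ`s of the final layer from a zeroed counter and a loaded countdown.** [folklore] -/
theorem runs_finalCZs (s : St) (N B : ℕ) (hcU : s.cU = List.replicate N true) (hiF : s.iF = List.replicate L false) (ht : s.t = [])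
    (hf : s.fl = []) (hnB : s.nB.length ≤ B) (hn1B : s.n1B.length ≤ B) (hsB : s.sB.length ≤ B) (hs1 : s.s1.length ≤ B) :
    Runs (final01 ;; loopCU (hopBody .sB .s1)) s.regs
      { s with o := (finalCZs L N s.sB s.s1 s.nB s.n1B).reverse ++ s.o, iF := numF L N, cU := [] }.regs
      (2 * (29 * L + 30 * B + 50) + (N * (29 * L + 20 * B + 47) + 1)) := by
  have hL : s.iF.length = L := by rw [hiF, List.length_replicate]
  rcases N with _ | _ | N
  · have hc : s.cU = [] := hcU
    have p1 : Runs (Com.pop R.cU (finalBody0 R.nB) (finalBody0 R.nB) Com.skip) s.regs s.regs 2 := Runs.pop_nil _ _ hc (Runs.skip _)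
    have p2 : Runs (Com.pop R.cU (finalBody0 R.n1B) (finalBody0 R.n1B) Com.skip) s.regs s.regs 2 := Runs.pop_nil _ _ hc (Runs.skip _)
    have p3 : Runs (loopCU (hopBody R.sB R.s1)) s.regs s.regs 1 := Runs.loop_nil _ _ hc
    refine ((p1.seq p2).seq p3).of_eq ?_ (by omega)
    rw [finalCZs_zero, List.reverse_nil, List.nil_append, numF, Function.iterate_zero, id, ← hiF, ← hc]
  · have hk : s.regs R.cU = true :: [] := hcU
    have b1 := runs_finalBody0 (tgt := R.nB) (Or.inl rfl) ({ s with cU := ([] : List Bool) } : St) ht hf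
    have p1 := Runs.pop_true' (finalBody0 R.nB) Com.skip hk (St.upd_cU s []) b1
    have p2 : Runs (Com.pop R.cU (finalBody0 R.n1B) (finalBody0 R.n1B) Com.skip) (finalBody0M R.nB ({ s with cU := ([] : List Bool) } : St)).regs
        (finalBody0M R.nB ({ s with cU := ([] : List Bool) } : St)).regs 2 := Runs.pop_nil _ _ rfl (Runs.skip _)
    have p3 : Runs (loopCU (hopBody R.sB R.s1)) (finalBody0M R.nB ({ s with cU := ([] : List Bool) } : St)).regs
        (finalBody0M R.nB ({ s with cU := ([] : List Bool) } : St)).regs 1 := Runs.loop_nil _ _ rfl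
    refine ((p1.seq p2).seq p3).of_eq ?_ ?_
    · simp [finalBody0M, finalCZs_one, hiF, numF]
    · simp only [St.regs_nB, hL]
      have h1 : (TokConv.ib true s.iF).length = L := by rw [length_ib, hL]
      omega
  · have hk : s.regs R.cU = true :: true :: List.replicate N true := hcU
    have b1 := runs_finalBody0 (tgt := R.nB) (Or.inl rfl) ({ s with cU := true :: List.replicate N true } : St) ht hf
    have p1 := Runs.pop_true' (finalBody0 R.nB) Com.skip hk (St.upd_cU s _) b1
    have hk2 : (finalBody0M R.nB ({ s with cU := true :: List.replicate N true } : St)).regs R.cU = true :: List.replicate N true := rfl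
    have b2 := runs_finalBody0 (tgt := R.n1B) (Or.inr rfl)
      ({ finalBody0M R.nB ({ s with cU := true :: List.replicate N true } : St) with cU := List.replicate N true } : St) ht hf
    have p2 := Runs.pop_true' (finalBody0 R.n1B) Com.skip hk2 (St.upd_cU _ _) b2
    have hiF2 : (finalBody0M R.n1B ({ finalBody0M R.nB ({ s with cU := true :: List.replicate N true } : St) with cU := List.replicate N true } : St)).iF
        = numF L 2 := by simp [finalBody0M, hiF, numF]
    have p3 := runs_hopLoop_from (sa := R.sB) (sb := R.s1) stageReg_sB stageReg_s1 _ L 2 B (List.replicate N true) rfl hiF2 ht hf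
      (by simpa [finalBody0M] using hsB) (by simpa [finalBody0M] using hs1)
    refine ((p1.seq p2).seq p3).of_eq ?_ ?_
    · simp only [finalBody0M, finalCZs_add_two, St.regs_nB, St.regs_n1B, St.regs_sB, St.regs_s1, List.length_replicate, List.reverse_append,
        List.append_assoc, hiF, numF, Function.iterate_succ, Function.iterate_zero, Function.comp_apply, id, Nat.add_comm 2 N]
    · simp only [finalBody0M, St.regs_nB, St.regs_n1B, List.length_replicate, hL]
      have h1 : (TokConv.ib true s.iF).length = L := by rw [length_ib, hL]
      have h2 : (TokConv.ib true (TokConv.ib true s.iF)).length = L := by rw [length_ib, h1]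
      have h3 : (N + 1 + 1) * (29 * L + 20 * B + 47) = N * (29 * L + 20 * B + 47) + 2 * (29 * L + 20 * B + 47) := by ring
      omega

/-- **The final layer**: `n1B := n + 1`, reset the counter, the `CZ`s, then `Z(n+1)`.
[cite: BremnerJozsaShepherdPRSA2011, Thm. 1 (proof) and Def. 3] -/
def finalLayer : Com R := mkN1B ;; mkZeroF ;; Com.copy .NU .cU .t .t2 ;; (final01 ;; loopCU (hopBody .sB .s1)) ;; emitZ [.n1B]

/-- A bound for the cost of the final layer (`B` bounds the numerals). [folklore] -/
def finalCost (L N B : ℕ) : ℕ := 19 * B + 12 + (2 * L + 13 * L + 6) + (10 * N + 3) + (2 * (29 * L + 30 * B + 50) + (N * (29 * L + 20 * B + 47) + 1)) + (10 * B + 22)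

/-- **The final layer runs**, printing `finalText`. [cite: BremnerJozsaShepherdPRSA2011, Thm. 1 (proof) and Def. 3] -/
theorem runs_finalLayer (s : St) (B : ℕ) (hE : Env L N s) (hn1B : s.n1B = []) (hcU : s.cU = [])
    (hiF : s.iF.length ≤ L) (hBn : s.nB.length ≤ B) (hB : (TokConv.incRes true s.nB).length ≤ B) (hsB : s.sB.length ≤ B) (hs1 : s.s1.length ≤ B) :
    Runs finalLayer s.regs
      { s with o := (finalText L N s.sB s.s1 s.nB (TokConv.incRes true s.nB)).reverse ++ s.o, n1B := TokConv.incRes true s.nB, iF := numF L N, cU := [] }.regs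
      (finalCost L N B) := by
  have e1 := runs_mkN1B s hn1B hE.ht hE.ht2 hE.hfl
  have e2 := runs_mkZeroF ({ s with n1B := TokConv.incRes true s.nB } : St) L hE.hLU hE.ht hE.ht2
  have e3 : Runs (Com.copy R.NU R.cU R.t R.t2) ({ s with n1B := TokConv.incRes true s.nB, iF := List.replicate L false, cU := ([] : List Bool) } : St).regs
      ({ s with n1B := TokConv.incRes true s.nB, iF := List.replicate L false, cU := List.replicate N true } : St).regs (10 * N + 3) :=
    (runs_copy (a := R.NU) (b := R.cU) (t := R.t) (u := R.t2) (by decide) (by decide) (by decide) (by decide) (by decide) (by decide) _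
      (by simpa using hE.ht) (by simpa using hE.ht2)).of_eq (by rw [St.upd_cU]; simp [hE.hNU]) (by simp [hE.hNU])
  have e4 := runs_finalCZs ({ s with n1B := TokConv.incRes true s.nB, iF := List.replicate L false, cU := List.replicate N true } : St) N B rfl rfl
    hE.ht hE.hfl (by simpa using hBn) (by simpa using hB) hsB hs1
  have e5 := runs_emitZ (P := [.n1B]) (by simp) (by simp)
    ({ s with n1B := TokConv.incRes true s.nB, iF := numF L N, cU := ([] : List Bool), o := (finalCZs L N s.sB s.s1 s.nB (TokConv.incRes true s.nB)).reverse ++ s.o } : St) hE.ht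
  simp only [cat_cons, cat_nil, List.append_nil, St.regs_n1B] at e5
  refine (e1.seq (e2.seq (e3.seq (e4.seq e5)))).of_eq ?_ ?_
  · simp [finalText, List.reverse_append]
  · simp only [hcU, List.length_nil, List.length_cons]
    unfold finalCost; omega

/-! ### Output assembly -/

/-- One tick of the ancilla count: `res := SU ++ SU ++ res` (`2 · 2^L` ones). [folklore] -/
def hdrTick : Com R := Com.copy .SU .res .t .t2 ;; Com.copy .SU .res .t .t2

/-- `hdrTick` runs. [folklore] -/
theorem runs_hdrTick (s : St) (ht : s.t = []) (ht2 : s.t2 = []) :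
    Runs hdrTick s.regs { s with res := s.SU ++ (s.SU ++ s.res) }.regs (2 * (10 * s.SU.length + 3)) := by
  have e1 : Runs (Com.copy R.SU R.res R.t R.t2) s.regs ({ s with res := s.SU ++ s.res } : St).regs (10 * s.SU.length + 3) :=
    (runs_copy (a := R.SU) (b := R.res) (t := R.t) (u := R.t2) (by decide) (by decide) (by decide) (by decide) (by decide) (by decide) _
      (by simpa using ht) (by simpa using ht2)).of_eq (by rw [St.upd_res]; rfl) le_rfl
  have e2 : Runs (Com.copy R.SU R.res R.t R.t2) ({ s with res := s.SU ++ s.res } : St).regs ({ s with res := s.SU ++ (s.SU ++ s.res) } : St).regs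
      (10 * s.SU.length + 3) :=
    (runs_copy (a := R.SU) (b := R.res) (t := R.t) (u := R.t2) (by decide) (by decide) (by decide) (by decide) (by decide) (by decide) _
      (by simpa using ht) (by simpa using ht2)).of_eq (by rw [St.upd_res]; rfl) le_rfl
  exact (e1.seq e2).of_eq rfl (by omega)

/-- The doubling loop of the numeral: `res := rep 2 (t.reverse) ++ res`, popping `t`. [folklore] -/
def dupLoop : Com R := Com.loop .t (Com.push .res true ;; Com.push .res true) (Com.push .res false ;; Com.push .res false)

/-- `dupLoop` runs. [folklore] -/
theorem runs_dupLoop : ∀ (w : List Bool) (s : St), s.t = w →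
    Runs dupLoop s.regs { s with t := [], res := rep 2 w.reverse ++ s.res }.regs (4 * w.length + 1)
  | [], s, h => by
    refine (Runs.loop_nil _ _ (show s.regs R.t = [] from h)).of_eq ?_ (by simp)
    simp only [List.reverse_nil, rep_nil, List.nil_append]; cases s; simp only at h; subst h; rfl
  | b :: w, s, h => by
    have hk : s.regs R.t = b :: w := h
    have hb : ∀ c : Bool, Runs (Com.push R.res c ;; Com.push R.res c) (Function.update s.regs R.t w) ({ s with t := w, res := c :: c :: s.res } : St).regs 2 := by
      intro c
      refine ((Runs.push R.res c _).seq (Runs.push R.res c _)).of_eq ?_ le_rfl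
      rw [St.upd_t, St.upd_res, St.upd_res]; rfl
    have ih := fun c : Bool => runs_dupLoop w ({ s with t := w, res := c :: c :: s.res } : St) rfl
    have e : ∀ c : Bool, ({ ({ s with t := w, res := c :: c :: s.res } : St) with t := [], res := rep 2 w.reverse ++ (c :: c :: s.res) } : St) =
        { s with t := [], res := rep 2 (b :: w).reverse ++ s.res } ↔ c = b := by
      intro c; constructor
      · intro hh; have := congrArg St.res hh; simp [rep_append, rep_cons, rep_nil] at this; exact this
      · rintro rfl; simp [rep_append, rep_cons, rep_nil]
    cases b
    · exact (Runs.loop_false hk (hb false) (ih false)).of_eq (congrArg St.regs ((e false).2 rfl)) (by simp; omega)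
    · exact (Runs.loop_true hk (hb true) (ih true)).of_eq (congrArg St.regs ((e true).2 rfl)) (by simp; omega)

/-- The separator `0 1` in front of `res`. [folklore] -/
def pushSep : Com R := Com.push .res true ;; Com.push .res false

/-- `pushSep` runs. [folklore] -/
theorem runs_pushSep (s : St) : Runs pushSep s.regs { s with res := false :: true :: s.res }.regs 2 := by
  refine ((Runs.push R.res true _).seq (Runs.push R.res false _)).of_eq ?_ le_rfl
  rw [St.upd_res, St.upd_res]; rfl

/-- **Output assembly**: `res := rep 2 nB ++ 0 1 ++ 1^{2 (2^L |sfU| + |mU|)} ++ 0 1 ++ reverse o`.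
[cite: BremnerJozsaShepherdPRSA2011, Def. 1 (the description of the circuit)] -/
def output : Com R :=
  Com.pour .o .res ;; pushSep ;; Com.copy .sfU .cU .t .t2 ;; loopCU hdrTick ;; Com.copy .mU .res .t .t2 ;; Com.copy .mU .res .t .t2 ;;
    pushSep ;; Com.pour .nB .t ;; dupLoop

/-- The header ones: `k` ticks of `SU ++ SU`. [folklore] -/
theorem hdrTick_iterate (s : St) : ∀ k : ℕ,
    (fun x : St => { x with res := x.SU ++ (x.SU ++ x.res) })^[k] s = { s with res := (List.replicate (2 * k) s.SU).flatten ++ s.res }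
  | 0 => by simp
  | k + 1 => by
    rw [Function.iterate_succ_apply', hdrTick_iterate s k]
    simp only [Nat.mul_succ, List.append_assoc, List.replicate_succ, List.flatten_cons]

/-- A flattened replicate of a replicate. [folklore] -/
theorem flatten_replicate_replicate (a b : ℕ) : (List.replicate a (List.replicate b true)).flatten = List.replicate (a * b) true := by
  induction a with
  | zero => simp
  | succ a ih => rw [List.replicate_succ, List.flatten_cons, ih, Nat.succ_mul, Nat.add_comm, List.replicate_add]

/-- **`output` runs** (from `res = cU = []`, `t`, `t2` empty, `SU`, `mU` all ones). [cite: BremnerJozsaShepherdPRSA2011, Def. 1] -/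
theorem runs_output (s : St) (S k m : ℕ) (hres : s.res = []) (hcU : s.cU = []) (ht : s.t = []) (ht2 : s.t2 = [])
    (hSU : s.SU = List.replicate S true) (hsfU : s.sfU = List.replicate k true) (hmU : s.mU = List.replicate m true) :
    Runs output s.regs
      { s with o := [], nB := [], res := rep 2 s.nB ++ (false :: true :: (List.replicate (2 * (S * k + m)) true ++ (false :: true :: s.o.reverse))) }.regs
      (3 * s.o.length + 1 + 2 + (10 * k + 3) + (k * (2 * (10 * S + 3) + 2) + 1) + 2 * (10 * m + 3) + 2 + (3 * s.nB.length + 1) + (4 * s.nB.length + 1)) := by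
  have e1 : Runs (Com.pour R.o R.res) s.regs ({ s with o := [], res := s.o.reverse } : St).regs (3 * s.o.length + 1) :=
    (runs_pour (a := R.o) (b := R.res) (by decide) s.regs).of_eq (by rw [St.upd_o, St.upd_res]; simp [hres]) le_rfl
  have e2 := runs_pushSep ({ s with o := [], res := s.o.reverse } : St)
  have e3 : Runs (Com.copy R.sfU R.cU R.t R.t2) ({ s with o := [], res := false :: true :: s.o.reverse } : St).regs
      ({ s with o := [], res := false :: true :: s.o.reverse, cU := s.sfU } : St).regs (10 * k + 3) :=
    (runs_copy (a := R.sfU) (b := R.cU) (t := R.t) (u := R.t2) (by decide) (by decide) (by decide) (by decide) (by decide) (by decide) _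
      (by simpa using ht) (by simpa using ht2)).of_eq (by rw [St.upd_cU]; simp [hcU]) (by simp [hsfU])
  have e4 := runs_loopCU_anyC (body := hdrTick) (f := fun x : St => { x with res := x.SU ++ (x.SU ++ x.res) })
    (P := fun x : St => x.t = [] ∧ x.t2 = [] ∧ x.SU = s.SU) (C := 2 * (10 * S + 3))
    (fun _ _ => rfl) (fun _ => rfl) (fun _ _ h => h) (fun _ h => h)
    (fun x ⟨h1, h2, h3⟩ => (runs_hdrTick x h1 h2).of_eq rfl (by rw [h3, hSU, List.length_replicate]))
    s.sfU ({ s with o := [], res := false :: true :: s.o.reverse, cU := s.sfU } : St) rfl ⟨ht, ht2, rfl⟩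
  rw [hdrTick_iterate] at e4
  set r4 : List Bool := (List.replicate (2 * s.sfU.length) s.SU).flatten ++ (false :: true :: s.o.reverse) with hr4
  have e5 : Runs (Com.copy R.mU R.res R.t R.t2) ({ s with o := [], res := r4, cU := ([] : List Bool) } : St).regs
      ({ s with o := [], res := s.mU ++ r4, cU := ([] : List Bool) } : St).regs (10 * m + 3) :=
    (runs_copy (a := R.mU) (b := R.res) (t := R.t) (u := R.t2) (by decide) (by decide) (by decide) (by decide) (by decide) (by decide) _
      (by simpa using ht) (by simpa using ht2)).of_eq (by rw [St.upd_res]; rfl) (by simp [hmU])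
  have e6 : Runs (Com.copy R.mU R.res R.t R.t2) ({ s with o := [], res := s.mU ++ r4, cU := ([] : List Bool) } : St).regs
      ({ s with o := [], res := s.mU ++ (s.mU ++ r4), cU := ([] : List Bool) } : St).regs (10 * m + 3) :=
    (runs_copy (a := R.mU) (b := R.res) (t := R.t) (u := R.t2) (by decide) (by decide) (by decide) (by decide) (by decide) (by decide) _
      (by simpa using ht) (by simpa using ht2)).of_eq (by rw [St.upd_res]; rfl) (by simp [hmU])
  have e7 := runs_pushSep ({ s with o := [], res := s.mU ++ (s.mU ++ r4), cU := ([] : List Bool) } : St)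
  have e8 : Runs (Com.pour R.nB R.t) ({ s with o := [], res := false :: true :: (s.mU ++ (s.mU ++ r4)), cU := ([] : List Bool) } : St).regs
      ({ s with o := [], res := false :: true :: (s.mU ++ (s.mU ++ r4)), cU := ([] : List Bool), nB := [], t := s.nB.reverse } : St).regs
      (3 * s.nB.length + 1) :=
    (runs_pour (a := R.nB) (b := R.t) (by decide) _).of_eq (by rw [St.upd_nB, St.upd_t]; simp [ht]) (by simp)
  have e9 := runs_dupLoop s.nB.reverse
    ({ s with o := [], res := false :: true :: (s.mU ++ (s.mU ++ r4)), cU := ([] : List Bool), nB := [], t := s.nB.reverse } : St) rfl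
  refine (e1.seq (e2.seq (e3.seq (e4.seq (e5.seq (e6.seq (e7.seq (e8.seq e9)))))))).of_eq ?_ ?_
  · have hones : s.mU ++ (s.mU ++ r4) = List.replicate (2 * (S * k + m)) true ++ (false :: true :: s.o.reverse) := by
      rw [hr4, hSU, hsfU, hmU, List.length_replicate, flatten_replicate_replicate, ← List.append_assoc, ← List.append_assoc,
        List.replicate_append_replicate, List.replicate_append_replicate]
      congr 2; ring
    simp only [List.reverse_reverse, hones, hcU, ht]
  · rw [hsfU, List.length_replicate, List.length_reverse]
    omega

/-! ### The post-selection length in unary -/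

/-- **`pl := 1^{2^L |sfU| + 1 - n}`**: the ancilla post-selection length of the compiled family in unary
(`stride (s_f + 1) + 1 - n`). [cite: BremnerJozsaShepherdPRSA2011, Def. 3] -/
def outputPl : Com R :=
  Com.copy .sfU .cU .t .t2 ;; loopCU (Com.copy .SU .pl .t .t2) ;; Com.push .pl true ;; Com.copy .nU .cU .t .t2 ;;
    loopCU (Com.pop .pl Com.skip Com.skip Com.skip)

/-- Popping an all-ones register `j` times. [folklore] -/
theorem pop_iterate (s : St) (P : ℕ) (hpl : s.pl = List.replicate P true) : ∀ j : ℕ,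
    (fun x : St => { x with pl := x.pl.tail })^[j] s = { s with pl := List.replicate (P - j) true }
  | 0 => by simp [← hpl]
  | j + 1 => by
    rw [Function.iterate_succ_apply', pop_iterate s P hpl j]
    simp only
    congr 1
    rcases Nat.lt_or_ge j P with h | h
    · obtain ⟨d, hd⟩ := Nat.exists_eq_add_of_lt h
      rw [hd, show j + d + 1 - j = d + 1 by omega, show j + d + 1 - (j + 1) = d by omega, List.replicate_succ, List.tail_cons]
    · rw [Nat.sub_eq_zero_of_le h, Nat.sub_eq_zero_of_le (Nat.le_succ_of_le h)]; rfl

/-- **`outputPl` runs** (from `pl = cU = []`). [cite: BremnerJozsaShepherdPRSA2011, Def. 3] -/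
theorem runs_outputPl (s : St) (S k n : ℕ) (hpl : s.pl = []) (hcU : s.cU = []) (ht : s.t = []) (ht2 : s.t2 = [])
    (hSU : s.SU = List.replicate S true) (hsfU : s.sfU = List.replicate k true) (hnU : s.nU = List.replicate n true) :
    Runs outputPl s.regs { s with pl := List.replicate (S * k + 1 - n) true }.regs
      (10 * k + 3 + (k * (10 * S + 3 + 2) + 1) + 1 + (10 * n + 3) + (n * 4 + 1)) := by
  have e1 : Runs (Com.copy R.sfU R.cU R.t R.t2) s.regs ({ s with cU := s.sfU } : St).regs (10 * k + 3) :=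
    (runs_copy (a := R.sfU) (b := R.cU) (t := R.t) (u := R.t2) (by decide) (by decide) (by decide) (by decide) (by decide) (by decide) _
      (by simpa using ht) (by simpa using ht2)).of_eq (by rw [St.upd_cU]; simp [hcU]) (by simp [hsfU])
  have e2 := runs_loopCU_anyC (body := Com.copy .SU .pl .t .t2) (f := fun x : St => { x with pl := x.SU ++ x.pl })
    (P := fun x : St => x.t = [] ∧ x.t2 = [] ∧ x.SU = s.SU) (C := 10 * S + 3)
    (fun _ _ => rfl) (fun _ => rfl) (fun _ _ h => h) (fun _ h => h)
    (fun x ⟨h1, h2, h3⟩ => (runs_copy (a := R.SU) (b := R.pl) (t := R.t) (u := R.t2) (by decide) (by decide) (by decide) (by decide) (by decide)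
      (by decide) x.regs (by simpa using h1) (by simpa using h2)).of_eq (by rw [St.upd_pl]; rfl) (by simp [h3, hSU]))
    s.sfU ({ s with cU := s.sfU } : St) rfl ⟨ht, ht2, rfl⟩
  have hit : ∀ (j : ℕ) (x : St), (fun x : St => { x with pl := x.SU ++ x.pl })^[j] x = { x with pl := (List.replicate j x.SU).flatten ++ x.pl } := by
    intro j; induction j with
    | zero => intro x; simp
    | succ j ih => intro x; rw [Function.iterate_succ_apply', ih]; simp [List.replicate_succ]
  rw [hit] at e2
  have hpl1 : (List.replicate s.sfU.length s.SU).flatten ++ s.pl = List.replicate (S * k) true := by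
    rw [hsfU, hSU, hpl, List.length_replicate, List.append_nil, flatten_replicate_replicate, Nat.mul_comm]
  rw [hpl1] at e2
  have e3 : Runs (Com.push R.pl true) ({ s with cU := ([] : List Bool), pl := List.replicate (S * k) true } : St).regs
      ({ s with cU := ([] : List Bool), pl := List.replicate (S * k + 1) true } : St).regs 1 :=
    (Runs.push _ _ _).of_eq (by rw [St.upd_pl, St.regs_pl, List.replicate_succ]) le_rfl
  have e4 : Runs (Com.copy R.nU R.cU R.t R.t2) ({ s with cU := ([] : List Bool), pl := List.replicate (S * k + 1) true } : St).regs
      ({ s with cU := s.nU, pl := List.replicate (S * k + 1) true } : St).regs (10 * n + 3) :=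
    (runs_copy (a := R.nU) (b := R.cU) (t := R.t) (u := R.t2) (by decide) (by decide) (by decide) (by decide) (by decide) (by decide) _
      (by simpa using ht) (by simpa using ht2)).of_eq (by rw [St.upd_cU]; simp) (by simp [hnU])
  have e5 := runs_loopCU_anyC (body := Com.pop .pl Com.skip Com.skip Com.skip) (f := fun x : St => { x with pl := x.pl.tail })
    (P := fun x : St => ∃ j, x.pl = List.replicate j true) (C := 2)
    (fun _ _ => rfl) (fun _ => rfl) (fun _ _ h => h) (fun x ⟨j, hj⟩ => ⟨j - 1, by simp only [hj]; cases j <;> simp [List.replicate_succ]⟩)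
    (fun x ⟨j, hj⟩ => by
      cases j with
      | zero =>
        have hk : x.regs R.pl = [] := hj
        exact (Runs.pop_nil _ _ hk (Runs.skip _)).of_eq (by rw [show x.pl.tail = x.pl by rw [hj]; rfl]) le_rfl
      | succ j =>
        have hk : x.regs R.pl = true :: List.replicate j true := hj
        exact (Runs.pop_true' _ _ hk (St.upd_pl x _) (Runs.skip _)).of_eq (by rw [hj]; rfl) le_rfl)
    s.nU ({ s with cU := s.nU, pl := List.replicate (S * k + 1) true } : St) rfl ⟨_, rfl⟩
  rw [pop_iterate _ (S * k + 1) rfl] at e5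
  refine (e1.seq (e2.seq (e3.seq (e4.seq e5)))).of_eq ?_ ?_
  · simp [hnU, hcU]
  · rw [hsfU, hnU, List.length_replicate, List.length_replicate]
    omega

end Asm

end HGadget.Hop

end Literature.Computability.QuantumComplexity
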